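import Summits.Ventures.HodgeRepro.FaceLattice
import Summits.Ventures.HodgeRepro.Night3FaceClosureGSet

/-!
# «S4-faces ⟹ S4» on the `(G, c)` model, unconditional: Lemma L discharged

Blind re-derivation cell `pub-hodge-repro`, seat `night-3`.  Imports typer-2's `FaceLattice` (Lemma L, every `m ≥ 1`) and
night-3's `Night3FaceClosureGSet` (the closure principle on typer's `(G, c)` model with Lemma L as its lattice hypothesis).
Namespace `HodgeRepro.Night3.GSet`.  Nothing here closes S4; no sealed file is touched; no Tier-2 item depends on this file.
-/

set_option autoImplicit false

namespace HodgeRepro.Night3.GSet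

open HodgeRepro.FaceLattice
open scoped Pointwise

variable {G : Type*} [Group G] [DecidableEq G] [Fintype G]

/-- **«S4-faces ⟹ S4» on the `(G, c)` model** — for every finite group `G` with a complex conjugation `c` and every predicate
`Alg` on multisets of CM types of `(G, c)` with `hadd` / `hcancel` (Lemma P (1) / (2)–(3)), `hpair` (Lefschetz (1,1) on
`{Φ, c • Φ}`) and `hface` (S4 on every census face `faceCornersMul c Φ p p'`, `p' ∉ place c p`), `Alg` holds on every zero-sum
multiset of CM types (`IsZeroSumG`).  Lemma L is typer-2's `span_pairs_faces_eq_zeroSum`. -/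
theorem alg_of_faces_gset_full {c : G} (hc : IsComplexConj c) (Alg : Multiset (Finset G) → Prop)
    (hadd : ∀ M N, IsZeroSumG c M → IsZeroSumG c N → Alg M → Alg N → Alg (M + N))
    (hcancel : ∀ M N, IsZeroSumG c M → IsZeroSumG c N → Alg (M + N) → Alg N → Alg M)
    (hpair : ∀ Φ, IsCMType c Φ → Alg {Φ, c • Φ})
    (hface : ∀ Φ p p', IsCMType c Φ → p' ∉ place c p → Alg (faceCornersMul c Φ p p'))
    (M : Multiset (Finset G)) (hM : IsZeroSumG c M) : Alg M :=
  alg_of_faces_gset' hc (fun _ hm => span_pairs_faces_eq_zeroSum hm) Alg hadd hcancel hpair hface M hM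

end HodgeRepro.Night3.GSet
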